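import Summits.QuantumFields.YangMills.Theorems.BalabanUVNodesN19RateEdgeHolderD4AtTrimmedLedgerReading
import Summits.QuantumFields.YangMills.Theorems.BalabanUVNodesSpineReadingOfRecord13CoPHV

/-!
# BalabanUVNodes ∕ N19 — THE TRIMMED LEDGER READING AT THE WITNESS READING `crOfRecord₁₃VAt K₀ (jc …) sh` (V edition): the sibling's trimmed link reading `hlinkTrim`
# (`…AtTrimmedLedgerReading`, p620894) at v5 ∕ «v6»'s witness spine reading (`PinnedAtLive jc sh cr` names `crOfRecord₁₃V (jc …) sh = crOfRecord₁₃VAt 0 (jc …) sh`), with (ii-m)'s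
# reference ledger ON THE FAMILY's LATTICES (`Pf K := F.P (Koff + K)`, `d₀ := 4`, `L₀ := F.L`) — the four lattice clauses and the volume sign DEFINITIONAL, five more rows and the binders
# `Pf d₀ L₀` out; N19′'s edge there.  The smallest displayed NODE-O obligation of this lineage at the reading stub 2 actually instantiates

Cell `pub-ymgap`, HUMAN RULING D-0062 (Track A), WIDTH SEAT `pub-ymgap-dag-n19-w3` (N19 NE7, seat 3 of 3), generation g4; bus INTENT-5.  Cluster item K3⁸ «SpineGivenEndpointR13SepCoPHV»
(stmt-QuantumFields-27366; K3 «v6» b4e55110ab73e679, stub 2's witness reading `PinnedAtLive jc sh cr` unchanged from v5); K3⁷ stmt-QuantumFields-20544 aside.  Filed `--kind proof --supports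
stmt-QuantumFields-27366 --as helper` (proves no registered stub).  COUNT-NEUTRAL.  THEOREMS ONLY; 0 `def`; 0 `sorry`; `N`-generic, guard-generic `G`; NO Theses import.  Imports the
sibling `…AtTrimmedLedgerReading` (this seat g4, p620894) and dag-n20-d's V edition `…SpineReadingOfRecord13CoPHV` (p590105) — CITED BY NAME, none edited; the pattern is g3's
`…AtN16PinnedReadingV` (p607224) one reading later (dag-n19-d's K pattern `latticeLetters_family F Koff`; `0 ≤ S.vol` by `T4Family.side_pos`).

WHAT THIS FILE PROVES (`S := crOfRecord₁₃VAt K₀ (jc F θ hP g₀ os) sh F θ hP g₀ os`, `R := rateCarriersOfRecord₁₃CoPH 𝔯 F θ hP g₀ os k`, `D := datumOfRecord₁₃CoPH F N θ hP`).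
* §1 ★★ `linkReadingAtTrimmedLedgerReading_crOfRecord₁₃VAt_of_linkReadingAtTrimmedLedgerReadingV` — this file's reading `hlinkTrimV` (the sibling's `hlinkTrim` at `S` minus the four
  lattice clauses and `0 ≤ S.vol`, the binders `Pf d₀ L₀` gone, `d₀ = 4` in the decay threshold; v9 − 58 conjuncts ∕ 14 binders) ⇒ the sibling's `hlinkTrim` text at
  `cr := fun F θ hP g₀ os => S` VERBATIM.
* §2 ★★ `h19HolderD4_crOfRecord₁₃VAt_of_linkReadingAtTrimmedLedgerReading_tuned` — N19′'s edge on tuned bare sequences at `S` (one application of the sibling's §2 at §1's reading).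
The by-name storeys `…TrimmedK3V5` (p623655) ∕ `…SlotK3R8` are `cr`-generic and apply at `cr := fun … => S` with §1's output as their `hlinkTrim`.

HONEST FRAMING.  Count-neutral kernel bookkeeping; `hlinkTrimV` (NODE O's world; 0 instances), `hdecT`, the pins, v5∕«v6»'s N16 rows, `D.Tuned` (K2⁷), the β-window (K1⁷) are
HYPOTHESES; `K₀ jc sh 𝔯 G ℓ ℓ₃ g B l₀ Λ` PARAMETERS (`sh` NOT inhabited; the cut `jc` free — plan's v6 BOOKING (5) on `(jc, sh)` stands).  NOT a proof of any stub or of K3⁸; nothing of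
Bałaban's asserted or instantiated (K0⁷ OPEN); NE7 NOT PRINTED ∕ NOT proved; N14 ∕ N16 ∕ N19 ∕ N22 NOT discharged; K3⁸ OPEN, NOT claimed; counts unmoved (typed 28∕28 · discharged 5∕27 ·
A 5∕28).  One finite four-torus at fixed ε — R4 closes the CONDITIONAL finite-𝕋⁴ rung `BalabanLadder.UV` only; NOT infinite volume ∕ OS ∕ mass gap; the YM mass gap (Clay) is NOT
proved by any of this.  Standard axioms.  Edits nothing.
-/

set_option autoImplicit false

noncomputable section

open Finset MeasureTheory
open scoped BigOperators Matrix Matrix.Norms.L2Operator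

namespace Summit.QuantumFields.YangMills.BalabanUVNodes.N19RateEdgeHolderD4AtTrimmedLedgerReadingV

open Literature.MathematicalPhysics.QuantumFieldTheory.Balaban1983to89
open T4OutputRate T4RecentScale T4GoodClassBudget T4CauchySum T4TowerRateComposition T4TowerRateDischarge
open T4EtaRateMin (Readings NE3Shape)
open T4RateLiaison (GaugeDominated)
open FlowStep (RGEqH prefixOf)
open TreeLengthTorus (TFaceConnected torusTreeLen)
open B12TreeDecay (kappa₀)
open Summit.QuantumFields.BalabanUV.T4Continuum
open AveragingDeficitDualResidual (dualC1 dualC2)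
open AveragingDeficitDerivWallProof (wallConst)
open AveragingDeficitPeriodicCounting (IsPeriodicDir)
open MinimalActionSandwich (IsMinimiser minAct)
open MinimalActionRate (sfClass)
open MinimalActionRefine (RegularSup gradConst)
open NE3EnergyShapes (IsUnitarySite IsPeriodicSite)
open NE3.LeafIndexSockets (LeafH3sup)
open Summit.QuantumFields.BalabanUV.T4Continuum.Spine
open Summit.QuantumFields.BalabanUV.T4Continuum.Spine.NE4 (runFlow)
open Summit.QuantumFields.BalabanUV.T4Continuum.NE1p.DressedRoot (DressedTower DressedStabilityStrict)
open Summit.QuantumFields.YangMills.BalabanUVNodes.N19LedgerLinkSync (LedgerDataSync LedgerAtSync)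
open YMDAG.UVSplit (SpineCarriers SpineRecordPred InputsPred U3Carriers RateCarriers RateRecordPred N14At N18At N22At ReadOutAt)
open Summit.QuantumFields.YangMills.BalabanUVNodes.N16HolderDefs (CovRootHolder N16HolderAt)
open Summit.QuantumFields.YangMills.BalabanUVNodes.SpineRatesHolder (RatesHolderAt)
open Literature.MathematicalPhysics.QuantumFieldTheory.Balaban1983to89.T4Continuum (T4Family ULoop)
open YMDAG.UVSplit (Datum RateReading₁₃CoPH rateCarriersOfRecord₁₃CoPH ne3OfRecord₁₁)
open Node00 (Stage13HParams datumOfRecord₁₃CoPH SiteSeqKey NE3Letters₁₁ ne3ConstLayerOfRecord₁₁ ne3NperOfRecord₁₁ ne3DomOfRecord₁₁)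
open Summit.QuantumFields.YangMills.BalabanUVNodes.N16PinnedLayer13CoPH (N16PinnedLoose N16LettersEnd rateCarriers_ne3_of_pinnedLoose)
open YMDAG.N14.TopBorn (ne1OfRecord obsSupNorm)
open YMDAG.N14.TopBorn (obsSupNorm_nonneg)
open Node00 (U3Letters₁₁)
open Literature.MathematicalPhysics.QuantumFieldTheory.Balaban1983to89.Node00.U3OfKernels (objectsOfRecord₁₃)
open Summit.QuantumFields.YangMills.BalabanUVNodes.N19RateEdgeHolderD4AtLedgerReading (h19HolderD4_datumOfRecord₁₃CoPH_of_linkReadingAtLedgerReading_tuned)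

open YMDAG.UVSplit (ShellSplit₁₃CoPH crOfRecord₁₃VAt)
open Summit.QuantumFields.YangMills.BalabanUVNodes.N19RateEdgeRecordRunLetters (latticeLetters_family)
open Summit.QuantumFields.YangMills.BalabanUVNodes.N19RateEdgeHolderD4AtTrimmedLedgerReading (h19HolderD4_datumOfRecord₁₃CoPH_of_linkReadingAtTrimmedLedgerReading_tuned)

variable {N : ℕ} [NeZero N]

section AtTrimmedLedgerReadingV

variable (K₀ : ℕ)
  (jc : (F : T4Family) → (θ : Stage13HParams F N) → θ.Provisos₁₃CoPH F N → (ℕ → ℝ) → List (ULoop F) → ℕ → ℕ) (sh : ShellSplit₁₃CoPH N K₀)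
  (𝔯 : RateReading₁₃CoPH N) (G : ∀ {F : T4Family}, Stage13HParams F N → Prop) {β : ℝ} (hβ1 : β ≤ 1)
  {ℓ₃ : T4Family → NE3Letters₁₁} {g B : T4Family → ℝ}
  (hlinkTrimV : ∀ (F : T4Family) (θ : Stage13HParams F N) (hP : θ.Provisos₁₃CoPH F N), G θ → θ.Admissible F N →
    ∀ (γ gIR b : ℝ) (g₀ : ℕ → ℝ), (datumOfRecord₁₃CoPH F N θ hP).Tuned γ gIR g₀ → γ ≤ θ.γ → γ ^ 2 ≤ Real.exp (-1) → 0 < b →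
    (∀ K m, 0 ≤ m → m < K → b ≤ (datumOfRecord₁₃CoPH F N θ hP).βfun m (prefixOf (runFlow (datumOfRecord₁₃CoPH F N θ hP) g₀ K) m)) →
    ∀ (os : List (ULoop F)) (k : ℕ),
      let S : SpineCarriers := crOfRecord₁₃VAt K₀ (jc F θ hP g₀ os) sh F θ hP g₀ os
      let R : RateCarriers N := rateCarriersOfRecord₁₃CoPH 𝔯 F θ hP g₀ os k
      let D : Datum F N := datumOfRecord₁₃CoPH F N θ hP
      letI := S.dec
      ∃ (_ : DecidableEq R.u3.C.Dom) (F' : Type) (ι' X' : Type) (_ : MeasurableSpace ι')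
        (L : LedgerDataSync R.u3.C F' ι' S.ι) (Rd : Readings ι' X') (bsel : (ℕ → ℝ) → ℝ) (EB : Functional R.u3.C R.u3.C.BgB)
        (g : ℕ → ℕ → ℝ)
        (uA : ℕ → ι' → R.u3.C.BgA) (uB : ℕ → ι' → R.u3.C.BgB)
        (Koff : ℕ) (cells : (K j : ℕ) → R.u3.C.Dom → Finset (Site (F.P (Koff + K)) j))
        (H033 : Flow → ℕ → Prop) (I : Type) (fam : I → B14.Sect2Data) (Lb βw : ℝ) (κ₁ : ℕ) (Gv Cl : ℝ) (K₁ : ℕ)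
        (c' t θ : ℝ)
        (sel : ℕ → (B7Prop1Explicit.Site 4 → Fin 4 → (Matrix (Fin N) (Fin N) ℂ)ˣ) → (B7Prop1Explicit.Site 4 → Fin 4 → (Matrix (Fin N) (Fin N) ℂ)ˣ))
        (rd : ι' → (B7Prop1Explicit.Site 4 → Fin 4 → (Matrix (Fin N) (Fin N) ℂ)ˣ)),
        (∀ K i, i ≤ K → g K i = runFlow D g₀ K i) ∧ (∀ K i, K < i → g K i = gIR) ∧
        EB = (fun s => R.u3.EB (bsel s) s) ∧
        (∀ (Sz : ℕ → ℝ → S.ι → ℕ → ℝ) (E₀ : ℝ) (m : ℕ) (a : ℝ) (Cw Λg : ℝ),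
          (∀ K t, |t| ≤ S.l₀ → ∀ τ ∈ S.T K \ S.Bad K t, ∀ v ∈ Rd.dom, ∀ j ≤ K,
            |∑ X ∈ L.fac K t τ with R.u3.C.scale X = j,
                (Real.log (Real.exp (EB (fun i => g (K + 1) (i + 1)) (uB K v) X
                    - EB (fun i => g (K + 1) (i + 1)) L.oneB X))
                  - Real.log (Real.exp (R.u3.EA (g K) (uA K v) X - R.u3.EA (g K) L.oneA X)))| ≤ Sz K t τ j) →
          0 ≤ E₀ → 0 < a → a < 1 →
          (∀ K t, |t| ≤ S.l₀ → ∀ τ ∈ S.T K \ S.Bad K t, ∀ j ≤ K,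
            Sz K t τ j ≤ S.vol * (E₀ * ((K : ℝ) + 1) ^ m * a ^ (K - j))) →
          (∀ K, Multiplicity (L.All K) R.u3.C.scale (fun X => Real.exp (-(R.u3.κ * R.u3.C.d X))) Cw S.vol Λg K) →
          (∀ K t, |t| ≤ S.l₀ → ∀ τ ∈ S.T K \ S.Bad K t,
            WindowMultiplicity (L.facO K t τ) L.scO L.wO Cw S.vol Λg (jlogOf L.Cl K) K) →
          1 ≤ Λg → L.θ' ≤ Λg →
          LedgerAtSync { L with S := Sz, E₀ := E₀, m := m, a := a, Cw := Cw, Λg := Λg } S.l₀ S.vol S.T S.Bad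
            (fun K t τ => S.A K t τ - S.shA K t τ) (fun K t τ => S.B K t τ - S.shB K t τ) Rd R.u3.EA EB R.u3.κ g uA uB
            R.u3.ω R.u3.ρ R.u3.θ (θ ^ ((3 : ℝ) * β - 2))) ∧
        (∀ K t, |t| ≤ S.l₀ → ∀ τ ∈ S.T K \ S.Bad K t,
          WindowMultiplicity (L.facO K t τ) L.scO L.wO L.Cw S.vol L.Λg (jlogOf L.Cl K) K) ∧
        0 ≤ L.Cw ∧ 1 ≤ L.Λg ∧ L.θ' ≤ L.Λg ∧
        kappa₀ (4 * 2 ^ 4) (2 * 4) ≤ R.u3.κ ∧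
        (∀ K, ∀ X ∈ L.All K,
          (cells K (R.u3.C.scale X + Koff) X).Nonempty ∧ TFaceConnected (cells K (R.u3.C.scale X + Koff) X)) ∧
        (∀ K j, Set.InjOn (cells K j) ↑((L.All K).filter fun X => R.u3.C.scale X + Koff = j)) ∧
        (∀ K, ∀ X ∈ L.All K, torusTreeLen (cells K (R.u3.C.scale X + Koff) X) ≤ R.u3.C.d X) ∧
        B14.Thm2Printed H033 fam Lb βw κ₁ ∧ βw < 1 ∧ 0 < βw ∧ 1 < Lb ∧ 1 ≤ Gv ∧ 0 ≤ Cl ∧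
        (∀ K t, |t| ≤ S.l₀ → ∀ τ ∈ S.T K \ S.Bad K t, ∀ j ≤ K, ∃ (i : I) (w : (fam i).Ω) (j' : ℕ),
          (fam i).flow.SatisfiesRG (fam i).K ∧ H033 (fam i).flow (fam i).K ∧ 1 ≤ j' ∧ j' ≤ (fam i).K ∧
          (fam i).K - j' = K - j ∧ (fam i).K ≤ K + K₁ ∧
          (∀ n, 0 ≤ (fam i).gammaVol n w) ∧ (fam i).gammaVol (fam i).K w ≤ S.vol ∧
          (∀ n, n < (fam i).K → n < jlogOf Cl (fam i).K → (fam i).gammaVol n w = 0) ∧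
          (∀ n, n < (fam i).K → jlogOf Cl (fam i).K ≤ n → (fam i).gammaVol n w ≤ S.vol * Gv ^ ((fam i).K - n))) ∧
        R.ne3.g = gradConst 4 c' ∧ 0 ≤ c' ∧ R.ne3.b ≤ t ∧ c' ≤ t ∧
        (2 : ℝ) ^ 91 * (R.ne3.L : ℝ) ^ 17 * t ≤ 1 ∧ (2 : ℝ) ^ 76 * (R.ne3.L : ℝ) ^ 12 * t ≤ R.ne3.ε ∧
        16 * B7Prop2Explicit.C0 4 * R.ne3.ε ≤ 3 ∧ 1024 * (4 + 1) * (4 + 4) * (R.ne3.L : ℝ) ^ 2 * R.ne3.ε ≤ 1 ∧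
        4 * ((ℓ₃ F).ε / B F) ≤ c' ∧
        LeafH3sup 4 R.ne3.L R.ne3.Nper R.ne3.ε R.ne3.b c' R.ne3.dom ∧
        (∀ V ∈ R.ne3.dom, ∀ k : ℕ, IsMinimiser 4 (sfClass 4 R.ne3.L R.ne3.Nper R.ne3.ε) R.ne3.L R.ne3.Nper k V (sel k V)) ∧
        (∀ V ∈ R.ne3.dom, ∀ k : ℕ, RegularSup 4 R.ne3.L R.ne3.Nper R.ne3.b c' k (sel k V)) ∧
        0 < θ ∧ θ ^ 6 = ((R.ne3.L : ℝ))⁻¹ ∧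
        (∀ v ∈ Rd.dom, rd v ∈ R.ne3.dom) ∧
        (∀ k, ∀ v ∈ Rd.dom, Rd.act k v = minAct 4 (sfClass 4 R.ne3.L R.ne3.Nper R.ne3.ε) R.ne3.L R.ne3.Nper k (rd v)) ∧
        (R.ne3.Nper : ℝ) ^ 4 ≤ Rd.vol ∧
        (∀ s ∈ Window γ, 0 < bsel s ∧ bsel s ≤ γ))

include hlinkTrimV

/-! ## §1 The trimmed ledger reading at the V reading IS the sibling's trimmed ledger reading at `cr := crOfRecord₁₃VAt K₀ (jc …) sh` -/

/-- ★★ **THE TRIMMED LEDGER READING AT THE V READING YIELDS THE SIBLING's TRIMMED LEDGER READING AT `cr := crOfRecord₁₃VAt K₀ (jc …) sh`** [bookkeeping]: this file's displayed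
hypothesis `hlinkTrimV` yields the sibling's `hlinkTrim` text VERBATIM at that `cr`: `Pf := fun K => F.P (Koff + K)`, `d₀ := 4`, `L₀ := F.L`, the lattice clauses by
`latticeLetters_family F Koff` (`S.vol = F.side ^ 4` is `rfl`), `0 ≤ S.vol` by `T4Family.side_pos`; everything else passed through.  Both readings are HYPOTHESES (0 instances);
N19 NOT discharged. -/
theorem linkReadingAtTrimmedLedgerReading_crOfRecord₁₃VAt_of_linkReadingAtTrimmedLedgerReadingV :
    ∀ (F : T4Family) (θ : Stage13HParams F N) (hP : θ.Provisos₁₃CoPH F N), G θ → θ.Admissible F N →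
    ∀ (γ gIR b : ℝ) (g₀ : ℕ → ℝ), (datumOfRecord₁₃CoPH F N θ hP).Tuned γ gIR g₀ → γ ≤ θ.γ → γ ^ 2 ≤ Real.exp (-1) → 0 < b →
    (∀ K m, 0 ≤ m → m < K → b ≤ (datumOfRecord₁₃CoPH F N θ hP).βfun m (prefixOf (runFlow (datumOfRecord₁₃CoPH F N θ hP) g₀ K) m)) →
    ∀ (os : List (ULoop F)) (k : ℕ),
      let S : SpineCarriers := crOfRecord₁₃VAt K₀ (jc F θ hP g₀ os) sh F θ hP g₀ os
      let R : RateCarriers N := rateCarriersOfRecord₁₃CoPH 𝔯 F θ hP g₀ os k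
      let D : Datum F N := datumOfRecord₁₃CoPH F N θ hP
      letI := S.dec
      ∃ (_ : DecidableEq R.u3.C.Dom) (F' : Type) (ι' X' : Type) (_ : MeasurableSpace ι')
        (L : LedgerDataSync R.u3.C F' ι' S.ι) (Rd : Readings ι' X') (bsel : (ℕ → ℝ) → ℝ) (EB : Functional R.u3.C R.u3.C.BgB)
        (g : ℕ → ℕ → ℝ)
        (uA : ℕ → ι' → R.u3.C.BgA) (uB : ℕ → ι' → R.u3.C.BgB)
        (Pf : ℕ → Params) (d₀ L₀ Koff : ℕ) (cells : (K j : ℕ) → R.u3.C.Dom → Finset (Site (Pf K) j))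
        (H033 : Flow → ℕ → Prop) (I : Type) (fam : I → B14.Sect2Data) (Lb βw : ℝ) (κ₁ : ℕ) (Gv Cl : ℝ) (K₁ : ℕ)
        (c' t θ : ℝ)
        (sel : ℕ → (B7Prop1Explicit.Site 4 → Fin 4 → (Matrix (Fin N) (Fin N) ℂ)ˣ) → (B7Prop1Explicit.Site 4 → Fin 4 → (Matrix (Fin N) (Fin N) ℂ)ˣ))
        (rd : ι' → (B7Prop1Explicit.Site 4 → Fin 4 → (Matrix (Fin N) (Fin N) ℂ)ˣ)),
        (∀ K i, i ≤ K → g K i = runFlow D g₀ K i) ∧ (∀ K i, K < i → g K i = gIR) ∧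
        EB = (fun s => R.u3.EB (bsel s) s) ∧
        (∀ (Sz : ℕ → ℝ → S.ι → ℕ → ℝ) (E₀ : ℝ) (m : ℕ) (a : ℝ) (Cw Λg : ℝ),
          (∀ K t, |t| ≤ S.l₀ → ∀ τ ∈ S.T K \ S.Bad K t, ∀ v ∈ Rd.dom, ∀ j ≤ K,
            |∑ X ∈ L.fac K t τ with R.u3.C.scale X = j,
                (Real.log (Real.exp (EB (fun i => g (K + 1) (i + 1)) (uB K v) X
                    - EB (fun i => g (K + 1) (i + 1)) L.oneB X))
                  - Real.log (Real.exp (R.u3.EA (g K) (uA K v) X - R.u3.EA (g K) L.oneA X)))| ≤ Sz K t τ j) →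
          0 ≤ E₀ → 0 < a → a < 1 →
          (∀ K t, |t| ≤ S.l₀ → ∀ τ ∈ S.T K \ S.Bad K t, ∀ j ≤ K,
            Sz K t τ j ≤ S.vol * (E₀ * ((K : ℝ) + 1) ^ m * a ^ (K - j))) →
          (∀ K, Multiplicity (L.All K) R.u3.C.scale (fun X => Real.exp (-(R.u3.κ * R.u3.C.d X))) Cw S.vol Λg K) →
          (∀ K t, |t| ≤ S.l₀ → ∀ τ ∈ S.T K \ S.Bad K t,
            WindowMultiplicity (L.facO K t τ) L.scO L.wO Cw S.vol Λg (jlogOf L.Cl K) K) →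
          1 ≤ Λg → L.θ' ≤ Λg →
          LedgerAtSync { L with S := Sz, E₀ := E₀, m := m, a := a, Cw := Cw, Λg := Λg } S.l₀ S.vol S.T S.Bad
            (fun K t τ => S.A K t τ - S.shA K t τ) (fun K t τ => S.B K t τ - S.shB K t τ) Rd R.u3.EA EB R.u3.κ g uA uB
            R.u3.ω R.u3.ρ R.u3.θ (θ ^ ((3 : ℝ) * β - 2))) ∧
        0 ≤ S.vol ∧
        (∀ K t, |t| ≤ S.l₀ → ∀ τ ∈ S.T K \ S.Bad K t,
          WindowMultiplicity (L.facO K t τ) L.scO L.wO L.Cw S.vol L.Λg (jlogOf L.Cl K) K) ∧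
        0 ≤ L.Cw ∧ 1 ≤ L.Λg ∧ L.θ' ≤ L.Λg ∧
        (∀ K, (Pf K).d = d₀) ∧ (∀ K, (Pf K).L = L₀) ∧ (∀ K, (Pf K).K = Koff + K) ∧
        (∀ K, (Fintype.card (Site (Pf K) (Pf K).K) : ℝ) = S.vol) ∧
        kappa₀ (4 * 2 ^ d₀) (2 * d₀) ≤ R.u3.κ ∧
        (∀ K, ∀ X ∈ L.All K,
          (cells K (R.u3.C.scale X + Koff) X).Nonempty ∧ TFaceConnected (cells K (R.u3.C.scale X + Koff) X)) ∧
        (∀ K j, Set.InjOn (cells K j) ↑((L.All K).filter fun X => R.u3.C.scale X + Koff = j)) ∧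
        (∀ K, ∀ X ∈ L.All K, torusTreeLen (cells K (R.u3.C.scale X + Koff) X) ≤ R.u3.C.d X) ∧
        B14.Thm2Printed H033 fam Lb βw κ₁ ∧ βw < 1 ∧ 0 < βw ∧ 1 < Lb ∧ 1 ≤ Gv ∧ 0 ≤ Cl ∧
        (∀ K t, |t| ≤ S.l₀ → ∀ τ ∈ S.T K \ S.Bad K t, ∀ j ≤ K, ∃ (i : I) (w : (fam i).Ω) (j' : ℕ),
          (fam i).flow.SatisfiesRG (fam i).K ∧ H033 (fam i).flow (fam i).K ∧ 1 ≤ j' ∧ j' ≤ (fam i).K ∧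
          (fam i).K - j' = K - j ∧ (fam i).K ≤ K + K₁ ∧
          (∀ n, 0 ≤ (fam i).gammaVol n w) ∧ (fam i).gammaVol (fam i).K w ≤ S.vol ∧
          (∀ n, n < (fam i).K → n < jlogOf Cl (fam i).K → (fam i).gammaVol n w = 0) ∧
          (∀ n, n < (fam i).K → jlogOf Cl (fam i).K ≤ n → (fam i).gammaVol n w ≤ S.vol * Gv ^ ((fam i).K - n))) ∧
        R.ne3.g = gradConst 4 c' ∧ 0 ≤ c' ∧ R.ne3.b ≤ t ∧ c' ≤ t ∧
        (2 : ℝ) ^ 91 * (R.ne3.L : ℝ) ^ 17 * t ≤ 1 ∧ (2 : ℝ) ^ 76 * (R.ne3.L : ℝ) ^ 12 * t ≤ R.ne3.ε ∧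
        16 * B7Prop2Explicit.C0 4 * R.ne3.ε ≤ 3 ∧ 1024 * (4 + 1) * (4 + 4) * (R.ne3.L : ℝ) ^ 2 * R.ne3.ε ≤ 1 ∧
        4 * ((ℓ₃ F).ε / B F) ≤ c' ∧
        LeafH3sup 4 R.ne3.L R.ne3.Nper R.ne3.ε R.ne3.b c' R.ne3.dom ∧
        (∀ V ∈ R.ne3.dom, ∀ k : ℕ, IsMinimiser 4 (sfClass 4 R.ne3.L R.ne3.Nper R.ne3.ε) R.ne3.L R.ne3.Nper k V (sel k V)) ∧
        (∀ V ∈ R.ne3.dom, ∀ k : ℕ, RegularSup 4 R.ne3.L R.ne3.Nper R.ne3.b c' k (sel k V)) ∧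
        0 < θ ∧ θ ^ 6 = ((R.ne3.L : ℝ))⁻¹ ∧
        (∀ v ∈ Rd.dom, rd v ∈ R.ne3.dom) ∧
        (∀ k, ∀ v ∈ Rd.dom, Rd.act k v = minAct 4 (sfClass 4 R.ne3.L R.ne3.Nper R.ne3.ε) R.ne3.L R.ne3.Nper k (rd v)) ∧
        (R.ne3.Nper : ℝ) ^ 4 ≤ Rd.vol ∧
        (∀ s ∈ Window γ, 0 < bsel s ∧ bsel s ≤ γ) := by
  intro F θ hP hG hθ γ gIR b g₀ ht hγle hγe hb0 hlow os k
  obtain ⟨iDom, F', ι', X', iMeas, L, Rd, bsel, EB, gr, uA, uB, hrest⟩ := hlinkTrimV F θ hP hG hθ γ gIR b g₀ ht hγle hγe hb0 hlow os k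
  obtain ⟨Koff, cells, H033, I, fam, Lb, βw, κ₁, Gv, Cl, K₁, c', t, ϑ, sel, rd, hrest⟩ := hrest
  obtain ⟨hgle, hggt, hEB, hL, homult, hCw, hΛg, hθΛ, hκ₀, hdom, hinj, hlen, hrest⟩ := hrest
  obtain ⟨hPd, hPL, hPK, hcard⟩ := latticeLetters_family F Koff
  have hvol : (0 : ℝ) ≤ (crOfRecord₁₃VAt K₀ (jc F θ hP g₀ os) sh F θ hP g₀ os).vol := pow_nonneg F.side_pos.le 4
  exact ⟨iDom, F', ι', X', iMeas, L, Rd, bsel, EB, gr, uA, uB, fun K => F.P (Koff + K), 4, F.L, Koff, cells, H033, I, fam, Lb, βw, κ₁, Gv, Cl, K₁, c', t, ϑ, sel, rd,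
    hgle, hggt, hEB, hL, hvol, homult, hCw, hΛg, hθΛ, hPd, hPL, hPK, hcard, hκ₀, hdom, hinj, hlen, hrest⟩

/-! ## §2 N19′'s edge on tuned bare sequences at the V reading -/

include hβ1 in
/-- ★★ **N19′'s EDGE AT THE V READING `crOfRecord₁₃VAt K₀ (jc …) sh` ON TUNED BARE SEQUENCES, AT THE TRIMMED LEDGER READING** [bookkeeping]: at every guarded admissible Stage-13
tuple, every bare sequence `g₀` TUNED to `gIR` within `]0, γ]` (`γ ≤ θ.γ`, `γ² ≤ e⁻¹`), `b ≤ β ≤ b′` along its runs of record with `0 < b` (K1⁷'s window), every `os k`, GIVEN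
`0 < R.u3.ρ` and node U2's smallness window: `PHolderD4 β D R → ∃ δ, NE7.Core S … δ ∧ Summable δ` for `S := crOfRecord₁₃VAt K₀ (jc F θ hP g₀ os) sh F θ hP g₀ os` — the sibling's §2
AT §1's reading (`2∕3 < β ≤ 1`, v5∕«v6»'s three N16 rows, the pins, `hdecT` — HYPOTHESES).  NOT NE7; N14 ∕ N16 ∕ N19 ∕ N22 NOT discharged; NOT a proof of any stub. -/
theorem h19HolderD4_crOfRecord₁₃VAt_of_linkReadingAtTrimmedLedgerReading_tuned (hβ23 : 2 / 3 < β)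
    (hdecT : ∀ (F : T4Family) (θ : Stage13HParams F N) (hP : θ.Provisos₁₃CoPH F N), G θ → θ.Admissible F N → ∀ γ : ℝ, γ ≤ θ.γ →
      ∀ (g₀ : ℕ → ℝ) (os : List (ULoop F)) (k : ℕ), ∃ E₀ : ℝ, 0 ≤ E₀ ∧
        DecayBound (rateCarriersOfRecord₁₃CoPH 𝔯 F θ hP g₀ os k).u3.EA (Window γ) E₀ (rateCarriersOfRecord₁₃CoPH 𝔯 F θ hP g₀ os k).u3.κ)
    {l₀ Λ : ℝ} (hl₀ : 0 ≤ l₀) (hΛ : 0 ≤ Λ) (hpin1 : ∀ (F : T4Family) (θ : Stage13HParams F N) (hP : θ.Provisos₁₃CoPH F N) (g₀ : ℕ → ℝ) (os : List (ULoop F)),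
      𝔯.ne1 F θ hP g₀ os = ne1OfRecord l₀ Λ F θ hP g₀ os)
    (ℓ : (F : T4Family) → Stage13HParams F N → U3Letters₁₁)
    (hpinU3 : ∀ (F : T4Family) (θ : Stage13HParams F N) (hP : θ.Provisos₁₃CoPH F N) (g₀ : ℕ → ℝ) (os : List (ULoop F)),
      (𝔯.lit F θ hP g₀ os).u3 = objectsOfRecord₁₃ F N θ.toStage13Params (ℓ F θ))
    (hpin : N16PinnedLoose 𝔯 ℓ₃ B) (hmatch : ∀ F : T4Family, 0 < B F ∧ (ℓ₃ F).ε / B F ≤ (ℓ₃ F).b) (hend : N16LettersEnd N g ℓ₃)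
    (F : T4Family) (θ : Stage13HParams F N) (hP : θ.Provisos₁₃CoPH F N) (hG : G θ) (hθ : θ.Admissible F N) {γ gIR b' : ℝ} {g₀ : ℕ → ℝ}
    (ht : (datumOfRecord₁₃CoPH F N θ hP).Tuned γ gIR g₀) (hγle : γ ≤ θ.γ) (hγe : γ ^ 2 ≤ Real.exp (-1)) {b : ℝ} (hb0 : 0 < b)
    (hlow : ∀ K m, 0 ≤ m → m < K →
      b ≤ (datumOfRecord₁₃CoPH F N θ hP).βfun m (prefixOf (runFlow (datumOfRecord₁₃CoPH F N θ hP) g₀ K) m))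
    (halong : ∀ K i, i < K →
      (datumOfRecord₁₃CoPH F N θ hP).βfun i (prefixOf (runFlow (datumOfRecord₁₃CoPH F N θ hP) g₀ K) i) ≤ b')
    (os : List (ULoop F)) (k : ℕ) (hρ0 : 0 < (rateCarriersOfRecord₁₃CoPH 𝔯 F θ hP g₀ os k).u3.ρ)
    (hsmall : (rateCarriersOfRecord₁₃CoPH 𝔯 F θ hP g₀ os k).u3.cr * (rateCarriersOfRecord₁₃CoPH 𝔯 F θ hP g₀ os k).u3.C₉ *
        (rateCarriersOfRecord₁₃CoPH 𝔯 F θ hP g₀ os k).u3.ω * (γ ^ 3 + 2 * γ / b) ≤ (1 - (rateCarriersOfRecord₁₃CoPH 𝔯 F θ hP g₀ os k).u3.ρ) / 2)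
    (hP4 : RatesHolderAt (datumOfRecord₁₃CoPH F N θ hP) (rateCarriersOfRecord₁₃CoPH 𝔯 F θ hP g₀ os k) β ∧
      ReadOutAt (datumOfRecord₁₃CoPH F N θ hP) (rateCarriersOfRecord₁₃CoPH 𝔯 F θ hP g₀ os k).u3 ∧
      (0 ≤ (rateCarriersOfRecord₁₃CoPH 𝔯 F θ hP g₀ os k).u3.ρ ∧ (rateCarriersOfRecord₁₃CoPH 𝔯 F θ hP g₀ os k).u3.ρ < 1)) :
    letI := (crOfRecord₁₃VAt K₀ (jc F θ hP g₀ os) sh F θ hP g₀ os).dec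
    ∃ δ : ℕ → ℝ, NE7.Core (crOfRecord₁₃VAt K₀ (jc F θ hP g₀ os) sh F θ hP g₀ os).l₀ (crOfRecord₁₃VAt K₀ (jc F θ hP g₀ os) sh F θ hP g₀ os).vol
      (crOfRecord₁₃VAt K₀ (jc F θ hP g₀ os) sh F θ hP g₀ os).T (crOfRecord₁₃VAt K₀ (jc F θ hP g₀ os) sh F θ hP g₀ os).Bad
      (fun K t τ => (crOfRecord₁₃VAt K₀ (jc F θ hP g₀ os) sh F θ hP g₀ os).A K t τ - (crOfRecord₁₃VAt K₀ (jc F θ hP g₀ os) sh F θ hP g₀ os).shA K t τ)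
      (fun K t τ => (crOfRecord₁₃VAt K₀ (jc F θ hP g₀ os) sh F θ hP g₀ os).B K t τ - (crOfRecord₁₃VAt K₀ (jc F θ hP g₀ os) sh F θ hP g₀ os).shB K t τ) δ ∧
      Summable δ :=
  h19HolderD4_datumOfRecord₁₃CoPH_of_linkReadingAtTrimmedLedgerReading_tuned (fun F θ hP g₀ os => crOfRecord₁₃VAt K₀ (jc F θ hP g₀ os) sh F θ hP g₀ os) 𝔯 G hβ1
    (linkReadingAtTrimmedLedgerReading_crOfRecord₁₃VAt_of_linkReadingAtTrimmedLedgerReadingV K₀ jc sh 𝔯 G hlinkTrimV) hβ23 hdecT hl₀ hΛ hpin1 ℓ hpinU3 hpin hmatch hend F θ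
    hP hG hθ ht hγle hγe hb0 hlow halong os k hρ0 hsmall hP4

end AtTrimmedLedgerReadingV
end Summit.QuantumFields.YangMills.BalabanUVNodes.N19RateEdgeHolderD4AtTrimmedLedgerReadingV
end
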